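import Summits.Ventures.DiscreteObjects.Hadamard.HadamardSignedAutParity
import Summits.Ventures.DiscreteObjects.Hadamard.SignedCycleClassCount
import Summits.Ventures.DiscreteObjects.Hadamard.AutomorphismTransfer668B
import Summits.Ventures.DiscreteObjects.Hadamard.CyclotomicFactorRoots

/-!
# Every signed automorphism of a Hadamard matrix of order `n` with `q ∥ n` has an even number of cycles of sign `+1` (kernel)

Framing: lottery ticket; floor = certified bounds/negative ranges.

Cell pub-namedobj (venture DiscreteObjects), target (H), hadamard gen 15.  The simplest cycle reading of the even-multiplicity
theorem (`HadamardSignedAutParity`, factor `h = X - 1`, which is self-reciprocal for every `q`): for an integer matrix `H`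
with `H Hᵀ = n·1`, an odd prime `q` with `q ∣ n`, `q² ∤ n`, and ANY signed automorphism `(π, κ, d, e)` whose permutation part
`κ` satisfies `κ^M = 1` with `q ∤ M`:

**`hadamard_signedAut_plain_cycles_even`**: `2 ∣ Σ_{L ≤ M} #{j : j lies on a κ-cycle of length L with sign product +1} / L`,
i.e. **the number of cycles of `(κ, e)` whose sign product `∏_{j ∈ cycle} e j` is `+1` is EVEN** (each summand is the
number of such cycles of length `L`; fixed columns `j` with `e j = 1` count as cycles of length `1`).  Dually for `(π, d)`
(`_row`).  For Hadamard matrices of order `4q`, `q` an odd prime (the open orders `668 = 4·167`, `716`, `892`, but also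
`12, 20, 28, 44, …`) this holds for every signed automorphism whose permutation parts have order prime to `q`
(`hadamard4q_signedAut_plain_cycles_even`; at `668`: `hadamard668_signedAut_plain_cycles_even` — every automorphism except
those of order `167` and `334`, the only orders divisible by `167` by gen 12).
Proof: `dim ker (Kt - 1)` is even (main theorem with `h = X - 1`); a cycle of length `L` and sign `ε` contributes `1` to it
iff `ε = 1` (`X - 1 ∣ X^L - 1`, `X - 1 ∤ X^L + 1` as `q` is odd), by `cycleClass_count` and the vanishing lemma, summed
over the partition of the index set into classes of constant `(L, ε)` (`finrank_ker_inf_supp_biUnion`).  Ours; no `sorry`.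
-/

open Polynomial Finset BigOperators Matrix

namespace Summit.Ventures.DiscreteObjects.Hadamard

open Literature.Combinatorics.Designs.GoethalsSeidel (IsHadamardMatrix)

section partition
variable {F : Type*} [Field F] {ι : Type*} [Fintype ι] [DecidableEq ι]
variable (κ : Equiv.Perm ι) (ee : ι → F) (Kt : Matrix ι ι F)

/-- nothing is supported on the empty set -/
lemma finrank_ker_inf_supp_empty (h : F[X]) :
    Module.finrank F ↥(LinearMap.ker (aeval (Matrix.toLinAlgEquiv' Kt) h) ⊓
      Submodule.pi {j | j ∉ (∅ : Finset ι)} (fun _ => (⊥ : Submodule F F))) = 0 := by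
  have e : LinearMap.ker (aeval (Matrix.toLinAlgEquiv' Kt) h) ⊓
      Submodule.pi {j | j ∉ (∅ : Finset ι)} (fun _ => (⊥ : Submodule F F)) = ⊥ := by
    rw [eq_bot_iff]
    intro v hv
    rw [Submodule.mem_bot]
    funext j
    exact (mem_supp_iff ∅ v).mp (Submodule.mem_inf.mp hv).2 j (by simp)
  rw [e, finrank_bot]

/-- **Partition sum.**  For pairwise disjoint `κ`-stable finsets `S c`, `c ∈ 𝓛`:
`dim (ker h(T) ∩ V_{⋃ S c}) = Σ_c dim (ker h(T) ∩ V_{S c})`. -/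
theorem finrank_ker_inf_supp_biUnion (hKt : Kt = Matrix.of fun j k => if k = κ j then ee j else 0) (h : F[X])
    {γ : Type*} [DecidableEq γ] (𝓛 : Finset γ) (S : γ → Finset ι) (hS : ∀ c ∈ 𝓛, ∀ j, κ j ∈ S c ↔ j ∈ S c)
    (hdisj : ∀ c ∈ 𝓛, ∀ c' ∈ 𝓛, c ≠ c' → Disjoint (S c) (S c')) :
    Module.finrank F ↥(LinearMap.ker (aeval (Matrix.toLinAlgEquiv' Kt) h) ⊓
        Submodule.pi {j | j ∉ 𝓛.biUnion S} (fun _ => (⊥ : Submodule F F))) =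
      ∑ c ∈ 𝓛, Module.finrank F ↥(LinearMap.ker (aeval (Matrix.toLinAlgEquiv' Kt) h) ⊓
        Submodule.pi {j | j ∉ S c} (fun _ => (⊥ : Submodule F F))) := by
  induction 𝓛 using Finset.induction_on with
  | empty => rw [Finset.sum_empty, Finset.biUnion_empty, finrank_ker_inf_supp_empty]
  | @insert a 𝓛 ha ih =>
    have hSa : ∀ j, κ j ∈ S a ↔ j ∈ S a := hS a (Finset.mem_insert_self a 𝓛)
    have hdisjB : Disjoint (𝓛.biUnion S) (S a) := by
      rw [Finset.disjoint_biUnion_left]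
      intro c hc
      exact hdisj c (Finset.mem_insert_of_mem hc) a (Finset.mem_insert_self a 𝓛) (fun e => ha (e ▸ hc))
    have e1 := finrank_ker_inf_supp_split κ ee Kt hKt h (insert a 𝓛 |>.biUnion S) (S a) hSa
    rw [Finset.biUnion_insert, Finset.union_inter_cancel_left, Finset.union_sdiff_left,
      Finset.sdiff_eq_self_iff_disjoint.mpr hdisjB] at e1
    rw [Finset.biUnion_insert, e1, Finset.sum_insert ha, ih (fun c hc => hS c (Finset.mem_insert_of_mem hc))
      (fun c hc c' hc' => hdisj c (Finset.mem_insert_of_mem hc) c' (Finset.mem_insert_of_mem hc'))]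

end partition

section plain
variable {ι : Type*} [Fintype ι] [DecidableEq ι]

omit [Fintype ι] [DecidableEq ι] in
/-- integer cycle signs are constant along the cycle -/
lemma cycleSign_apply_int {κ : Equiv.Perm ι} {e : ι → ℤ} (he : ∀ j, e j = 1 ∨ e j = -1) {L : ℕ} {j : ι}
    (hj : (κ ^ L) j = j) : ∏ i ∈ range L, e ((κ ^ i) (κ j)) = ∏ i ∈ range L, e ((κ ^ i) j) := by
  have e1 : ∏ i ∈ range (L + 1), e ((κ ^ i) j) = (∏ i ∈ range L, e ((κ ^ i) (κ j))) * e j := by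
    rw [Finset.prod_range_succ']
    simp only [pow_zero, Equiv.Perm.one_apply, pow_succ, Equiv.Perm.mul_apply]
  have e2 : ∏ i ∈ range (L + 1), e ((κ ^ i) j) = (∏ i ∈ range L, e ((κ ^ i) j)) * e j := by
    rw [Finset.prod_range_succ, hj]
  exact mul_right_cancel₀ (pm_ne_zero (he j)) (e1.symm.trans e2)

/-- a product of `±1` values is `±1` -/
lemma prod_range_pm' {f : ℕ → ℤ} (hf : ∀ t, f t = 1 ∨ f t = -1) (k : ℕ) :
    ∏ t ∈ range k, f t = 1 ∨ ∏ t ∈ range k, f t = -1 := by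
  induction k with
  | zero => left; simp
  | succ k ih =>
    rw [Finset.prod_range_succ]
    rcases ih with h | h <;> rcases hf k with h' | h' <;> simp [h, h']

/-- **Even number of cycles of sign `+1` (columns).**  See the module docstring: the `L`-th summand is the number of
`κ`-cycles of length `L` on which `∏ e = 1`. -/
theorem hadamard_signedAut_plain_cycles_even (H : Matrix ι ι ℤ) {n : ℤ} (hH : H * Hᵀ = n • (1 : Matrix ι ι ℤ))
    {q : ℕ} [Fact q.Prime] (hqn : (q : ℤ) ∣ n) (hq2 : ¬ (q : ℤ) ^ 2 ∣ n) (hqodd : q ≠ 2)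
    {π κ : Equiv.Perm ι} {d e : ι → ℤ} (hA : IsSignedAut H π κ d e)
    {M : ℕ} (hM : 0 < M) (hκM : ∀ j, (κ ^ M) j = j) (hqM : ((2 * M : ℕ) : ZMod q) ≠ 0) :
    2 ∣ ∑ L ∈ range (M + 1),
      (univ.filter (fun j => Function.minimalPeriod κ j = L ∧ ∏ i ∈ range L, e ((κ ^ i) j) = 1)).card / L := by
  have he := hA.2.1
  have hq : q.Prime := Fact.out
  have h2F : (2 : ZMod q) ≠ 0 := by
    intro h0
    have : ((2 : ℕ) : ZMod q) = 0 := by exact_mod_cast h0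
    rw [ZMod.natCast_eq_zero_iff] at this
    exact hqodd ((Nat.prime_dvd_prime_iff_eq hq Nat.prime_two).mp this)
  have hMF : (M : ZMod q) ≠ 0 := by
    intro h0
    apply hqM
    push_cast
    rw [h0, mul_zero]
  -- the pull-back and the main theorem with h = X - C 1
  have hee : ∀ j, (fun j => ((e j : ℤ) : ZMod q)) j * (fun j => ((e j : ℤ) : ZMod q)) j = 1 :=
    signedAut_sign_sq hA q
  set Kt : Matrix ι ι (ZMod q) := Matrix.of fun j k => if k = κ j then ((e j : ℤ) : ZMod q) else 0 with hKt
  have hirr : Irreducible (X - C 1 : (ZMod q)[X]) := irreducible_X_sub_C (1 : ZMod q)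
  have hmain := hadamard_signedAut_even_multiplicity H hH hqn hq2 hA Kt hKt hM hκM hqM (m := 1) (j := 0) (one_dvd _)
    (by norm_num) hirr (⟨1, by rw [mul_one, pow_one, C_1]⟩ : (X - C 1 : (ZMod q)[X]) ∣ X ^ 1 - 1)
  rw [natDegree_X_sub_C, mul_one] at hmain
  -- periods
  have hPM : ∀ j, Function.IsPeriodicPt κ M j := fun j => by
    rw [Function.IsPeriodicPt, Function.IsFixedPt, Equiv.Perm.iterate_eq_pow]
    exact hκM j
  have hperiodic : ∀ j, j ∈ Function.periodicPts κ := fun j => Function.mem_periodicPts.mpr ⟨M, hM, hPM j⟩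
  have hLpos : ∀ j, 0 < Function.minimalPeriod κ j := fun j => (hPM j).minimalPeriod_pos hM
  have hLle : ∀ j, Function.minimalPeriod κ j ≤ M := fun j => (hPM j).minimalPeriod_le hM
  have hLdvd : ∀ j, Function.minimalPeriod κ j ∣ M := fun j => (hPM j).minimalPeriod_dvd
  have hLfix : ∀ j, (κ ^ Function.minimalPeriod κ j) j = j := fun j => by
    have := Function.iterate_minimalPeriod (f := κ) (x := j)
    rwa [Equiv.Perm.iterate_eq_pow] at this
  have hLmin : ∀ j t, 0 < t → t < Function.minimalPeriod κ j → (κ ^ t) j ≠ j := by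
    intro j t ht0 ht hfix
    have hp : Function.IsPeriodicPt κ t j := by
      rw [Function.IsPeriodicPt, Function.IsFixedPt, Equiv.Perm.iterate_eq_pow]
      exact hfix
    exact absurd (hp.minimalPeriod_le ht0) (by omega)
  have hLκ : ∀ j, Function.minimalPeriod κ (κ j) = Function.minimalPeriod κ j := fun j =>
    Function.minimalPeriod_apply (hperiodic j)
  -- the classes of constant (length, sign)
  set S : ℕ × ℤ → Finset ι := fun c =>
    univ.filter (fun j => Function.minimalPeriod κ j = c.1 ∧ ∏ i ∈ range c.1, e ((κ ^ i) j) = c.2) with hSdef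
  have hmemS : ∀ c j, j ∈ S c ↔ Function.minimalPeriod κ j = c.1 ∧ ∏ i ∈ range c.1, e ((κ ^ i) j) = c.2 :=
    fun c j => by rw [hSdef]; simp only [mem_filter, mem_univ, true_and]
  set 𝓛 : Finset (ℕ × ℤ) := range (M + 1) ×ˢ ({1, -1} : Finset ℤ) with h𝓛
  have hSκ : ∀ c ∈ 𝓛, ∀ j, κ j ∈ S c ↔ j ∈ S c := by
    intro c _ j
    rw [hmemS, hmemS, hLκ j]
    constructor
    · rintro ⟨hL, hs⟩
      refine ⟨hL, ?_⟩
      rw [← hs, ← hL, cycleSign_apply_int he (hLfix j)]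
    · rintro ⟨hL, hs⟩
      refine ⟨hL, ?_⟩
      rw [← hs, ← hL, cycleSign_apply_int he (hLfix j)]
  have hdisj : ∀ c ∈ 𝓛, ∀ c' ∈ 𝓛, c ≠ c' → Disjoint (S c) (S c') := by
    intro c _ c' _ hcc'
    rw [Finset.disjoint_left]
    intro j hj hj'
    obtain ⟨h1, h2⟩ := (hmemS c j).mp hj
    obtain ⟨h1', h2'⟩ := (hmemS c' j).mp hj'
    apply hcc'
    have e1 : c.1 = c'.1 := h1.symm.trans h1'
    refine Prod.ext e1 ?_
    rw [← h2, ← h2', e1]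
  have hcover : 𝓛.biUnion S = univ := by
    apply Finset.eq_univ_of_forall
    intro j
    rw [Finset.mem_biUnion]
    refine ⟨(Function.minimalPeriod κ j, ∏ i ∈ range (Function.minimalPeriod κ j), e ((κ ^ i) j)), ?_,
      (hmemS _ j).mpr ⟨rfl, rfl⟩⟩
    rw [h𝓛, Finset.mem_product]
    refine ⟨mem_range.mpr (by have := hLle j; omega), ?_⟩
    rcases prod_range_pm' (fun t => he ((κ ^ t) j)) (Function.minimalPeriod κ j) with h1 | h1
    · rw [h1]; simp
    · rw [h1]; simp
  -- per-class dimensions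
  have hclass : ∀ c ∈ 𝓛,
      Module.finrank (ZMod q) ↥(LinearMap.ker (aeval (Matrix.toLinAlgEquiv' Kt) (X - C 1 : (ZMod q)[X])) ⊓
        Submodule.pi {j | j ∉ S c} (fun _ => (⊥ : Submodule (ZMod q) (ZMod q)))) =
        if c.2 = 1 then (S c).card / c.1 else 0 := by
    intro c hc
    obtain ⟨L, ε⟩ := c
    have hε : ε = 1 ∨ ε = -1 := by
      rw [h𝓛, Finset.mem_product] at hc
      simpa using hc.2
    dsimp only
    have hper : ∀ j ∈ S (L, ε), (κ ^ L) j = j := fun j hj => by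
      have e1 := ((hmemS _ j).mp hj).1
      dsimp only at e1
      rw [← e1]
      exact hLfix j
    have hmin : ∀ j ∈ S (L, ε), ∀ t, 0 < t → t < L → (κ ^ t) j ≠ j := fun j hj t ht0 ht => by
      have e1 := ((hmemS _ j).mp hj).1
      dsimp only at e1
      apply hLmin j t ht0
      rw [e1]
      exact ht
    have hsgn : ∀ j ∈ S (L, ε), ∏ i ∈ range L, (fun j => ((e j : ℤ) : ZMod q)) ((κ ^ i) j) = ((ε : ℤ) : ZMod q) :=
      fun j hj => by
        have e2 := ((hmemS _ j).mp hj).2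
        dsimp only at e2
        rw [← e2, Int.cast_prod]
    rcases Nat.eq_zero_or_pos L with hL0 | hLpos'
    · -- L = 0: the class is empty
      have hempty : S (L, ε) = ∅ := by
        rw [Finset.eq_empty_iff_forall_notMem]
        intro j hj
        have e1 := ((hmemS _ j).mp hj).1
        dsimp only at e1
        have := hLpos j
        omega
      rw [hempty, finrank_ker_inf_supp_empty, Finset.card_empty, Nat.zero_div]
      split_ifs <;> rfl
    rcases hε with rfl | rfl
    · -- plain class: `X - 1` contributes one dimension per cycle
      rw [if_pos rfl]
      by_cases hne : S (L, 1) = ∅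
      · rw [hne, finrank_ker_inf_supp_empty, Finset.card_empty, Nat.zero_div]
      obtain ⟨j₀, hj₀⟩ := Finset.nonempty_iff_ne_empty.mpr hne
      have hLM : L ∣ M := by
        have e1 := ((hmemS _ j₀).mp hj₀).1
        dsimp only at e1
        rw [← e1]
        exact hLdvd j₀
      have hLF : (L : ZMod q) ≠ 0 := by
        intro h0
        apply hMF
        obtain ⟨k, hk⟩ := hLM
        rw [hk]
        push_cast
        rw [h0, zero_mul]
      have hhg : (X - C 1 : (ZMod q)[X]) * (∑ i ∈ range L, X ^ i) = X ^ L - C 1 := by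
        rw [mul_comm, C_1, geom_sum_mul]
      have hcop : IsCoprime (X - C 1 : (ZMod q)[X]) (∑ i ∈ range L, X ^ i) := by
        have hsep : (X ^ L - C 1 : (ZMod q)[X]).Separable := separable_X_pow_sub_C (1 : ZMod q) hLF one_ne_zero
        rw [← hhg] at hsep
        exact hsep.isCoprime
      have hsgn1 : ∀ j ∈ S (L, 1), ∏ i ∈ range L, (fun j => ((e j : ℤ) : ZMod q)) ((κ ^ i) j) = (1 : ZMod q) :=
        fun j hj => by rw [hsgn j hj, Int.cast_one]
      have hcount := cycleClass_count κ (fun j => ((e j : ℤ) : ZMod q)) Kt hee hKt (S (L, 1)) (hSκ (L, 1) hc) hLpos'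
        hper hmin hsgn1 hhg hcop
      rw [natDegree_X_sub_C, one_mul] at hcount
      rw [← hcount, Nat.mul_div_cancel_left _ hLpos']
    · -- nega class: `X - 1` does not divide `X^L + 1`
      rw [if_neg (by norm_num)]
      have h0 := ker_inf_supp_eq_bot_of_isCoprime κ (fun j => ((e j : ℤ) : ZMod q)) Kt hee hKt
        (h := (X - C 1 : (ZMod q)[X])) (S (L, -1)) (fun _ => L) hper ?_
      · rw [h0, finrank_bot]
      · intro j hj
        rw [hsgn j hj, Int.cast_neg, Int.cast_one, X_pow_sub_C_neg_one, Irreducible.coprime_iff_not_dvd hirr,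
          dvd_iff_isRoot, IsRoot.def, eval_add, eval_pow, eval_X, eval_one, one_pow]
        intro h11
        apply h2F
        rw [← h11]
        norm_num
  -- sum over the partition
  have hsplit := finrank_ker_inf_supp_biUnion κ (fun j => ((e j : ℤ) : ZMod q)) Kt hKt (X - C 1 : (ZMod q)[X]) 𝓛 S
    hSκ hdisj
  rw [hcover, ker_inf_supp_univ, Finset.sum_congr rfl hclass, h𝓛, Finset.sum_product] at hsplit
  have hpair : ∀ L ∈ range (M + 1), ∑ ε ∈ ({1, -1} : Finset ℤ),
      (if ((L, ε) : ℕ × ℤ).2 = 1 then (S (L, ε)).card / ((L, ε) : ℕ × ℤ).1 else 0) = (S (L, 1)).card / L := by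
    intro L _
    rw [Finset.sum_pair (by norm_num : (1 : ℤ) ≠ -1)]
    simp
  rw [Finset.sum_congr rfl hpair] at hsplit
  rw [hsplit] at hmain
  exact hmain

/-- **Even number of cycles of sign `+1`, rows** (the column theorem for `Hᵀ`). -/
theorem hadamard_signedAut_plain_cycles_even_row (H : Matrix ι ι ℤ) {n : ℤ} (hH : H * Hᵀ = n • (1 : Matrix ι ι ℤ))
    {q : ℕ} [Fact q.Prime] (hqn : (q : ℤ) ∣ n) (hq2 : ¬ (q : ℤ) ^ 2 ∣ n) (hqodd : q ≠ 2)
    {π κ : Equiv.Perm ι} {d e : ι → ℤ} (hA : IsSignedAut H π κ d e)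
    {M : ℕ} (hM : 0 < M) (hπM : ∀ i, (π ^ M) i = i) (hqM : ((2 * M : ℕ) : ZMod q) ≠ 0) :
    2 ∣ ∑ L ∈ range (M + 1),
      (univ.filter (fun i => Function.minimalPeriod π i = L ∧ ∏ t ∈ range L, d ((π ^ t) i) = 1)).card / L := by
  have hn : n ≠ 0 := by
    rintro rfl
    exact hq2 (dvd_zero _)
  have hHt : Hᵀ * Hᵀᵀ = n • (1 : Matrix ι ι ℤ) := by
    rw [Matrix.transpose_transpose]
    exact transpose_mul_self_of_mul_transpose H n hn hH
  exact hadamard_signedAut_plain_cycles_even Hᵀ hHt hqn hq2 hqodd (isSignedAut_transpose hA) hM hπM hqM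

/-- **H(4q), `q` an odd prime: every signed automorphism whose permutation parts have order prime to `q` has an even
number of cycles of sign `+1`, on rows and on columns.**  (`M` = any common exponent with `π^M = κ^M = 1`, `q ∤ M`; the
`L`-th summands are the numbers of such cycles of length `L`.) -/
theorem hadamard4q_signedAut_plain_cycles_even {q : ℕ} (hq : q.Prime) (hqodd : q ≠ 2) {H : Matrix ι ι ℤ}
    (hH : IsHadamardMatrix H) (hι : Fintype.card ι = 4 * q) {π κ : Equiv.Perm ι} {d e : ι → ℤ}
    (haut : IsSignedAut H π κ d e) {M : ℕ} (hM : 0 < M) (hπM : ∀ i, (π ^ M) i = i) (hκM : ∀ j, (κ ^ M) j = j)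
    (hqM : ¬ q ∣ M) :
    (2 ∣ ∑ L ∈ range (M + 1),
      (univ.filter (fun i => Function.minimalPeriod π i = L ∧ ∏ t ∈ range L, d ((π ^ t) i) = 1)).card / L) ∧
    (2 ∣ ∑ L ∈ range (M + 1),
      (univ.filter (fun j => Function.minimalPeriod κ j = L ∧ ∏ t ∈ range L, e ((κ ^ t) j) = 1)).card / L) := by
  haveI : Fact q.Prime := ⟨hq⟩
  have hHn : H * Hᵀ = ((4 * q : ℕ) : ℤ) • (1 : Matrix ι ι ℤ) := by rw [hH.2, hι]
  have hqn : (q : ℤ) ∣ ((4 * q : ℕ) : ℤ) := ⟨4, by push_cast; ring⟩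
  have hqn2 : ¬ (q : ℤ) ^ 2 ∣ ((4 * q : ℕ) : ℤ) := by
    rintro ⟨c, hc⟩
    push_cast at hc
    have hq0 : (q : ℤ) ≠ 0 := by exact_mod_cast hq.ne_zero
    have h4 : (4 : ℤ) = q * c := by
      apply mul_left_cancel₀ hq0
      linear_combination hc
    have hdvd : (q : ℤ) ∣ ((4 : ℕ) : ℤ) := ⟨c, by exact_mod_cast h4⟩
    have hdvd' : q ∣ 2 ^ 2 := by norm_num; exact_mod_cast hdvd
    exact hqodd ((Nat.prime_dvd_prime_iff_eq hq Nat.prime_two).mp (hq.dvd_of_dvd_pow hdvd'))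
  have hqM' : ((2 * M : ℕ) : ZMod q) ≠ 0 := by
    rw [Ne, ZMod.natCast_eq_zero_iff]
    intro h
    rcases (Nat.Prime.dvd_mul hq).mp h with h2 | h2
    · exact hqodd ((Nat.prime_dvd_prime_iff_eq hq Nat.prime_two).mp h2)
    · exact hqM h2
  exact ⟨hadamard_signedAut_plain_cycles_even_row H hHn hqn hqn2 hqodd haut hM hπM hqM',
    hadamard_signedAut_plain_cycles_even H hHn hqn hqn2 hqodd haut hM hκM hqM'⟩

/-- **H(668)**: every signed automorphism with `π^M = κ^M = 1`, `167 ∤ M`, has an even number of cycles of sign `+1` on rows and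
on columns (by gen 12, `167 ∣ |g|` only for `|g| ∈ {167, 334}`; so this covers every other automorphism). -/
theorem hadamard668_signedAut_plain_cycles_even {H : Matrix ι ι ℤ} (hH : IsHadamardMatrix H)
    (hι : Fintype.card ι = 668) {π κ : Equiv.Perm ι} {d e : ι → ℤ} (haut : IsSignedAut H π κ d e) {M : ℕ}
    (hM : 0 < M) (hπM : ∀ i, (π ^ M) i = i) (hκM : ∀ j, (κ ^ M) j = j) (h167 : ¬ 167 ∣ M) :
    (2 ∣ ∑ L ∈ range (M + 1),
      (univ.filter (fun i => Function.minimalPeriod π i = L ∧ ∏ t ∈ range L, d ((π ^ t) i) = 1)).card / L) ∧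
    (2 ∣ ∑ L ∈ range (M + 1),
      (univ.filter (fun j => Function.minimalPeriod κ j = L ∧ ∏ t ∈ range L, e ((κ ^ t) j) = 1)).card / L) :=
  hadamard4q_signedAut_plain_cycles_even (q := 167) (by norm_num) (by norm_num) hH (by rw [hι]) haut hM hπM hκM h167


end plain

end Summit.Ventures.DiscreteObjects.Hadamard
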